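import Mathlib
import Literature.NumberTheory.Transcendental.KZSemiCanonicalReductionProofs
import Summits.KontsevichZagierPeriods.KontsevichZagierPeriods.Theses.LiouvilleUnfolding

/-!
# `CVSQuarter` (stmt-KontsevichZagierPeriods-2838) — the Cresson–Viu-Sos calibration `∫∫ x/y = 1/4`

Support item of route `LiouvilleUnfolding` (rank 9), the unit test of the card: Cresson–Viu-Sos
[CVS 2022, §2.1] compute `∫∫_{0<x<1<y<x+1} x/y dy dx = ∫₀¹ x log(1+x) dx = 1/4` as the example of a
Fubini + Newton–Leibniz step that LEAVES the semialgebraic class (the intermediate integrand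
`x log(1+x)` is transcendental). The item asks for the same identity INSIDE the four-move calculus
of `KZCalculus.lean`: `KZ.Equivalent r r'` for every representation `r = [{0<x<1<y<x+1}, x/y]`
(`KZ.IntegralRep 2`) and every constant representation `r' = [pt, 1/4]` (`KZ.IntegralRep 0`).

Proof (the planner's unfolding chain; the given domain IS the unfolding of `x log(1+x)`, so one
integrates in the other order and no logarithm ever appears):

1. reindex = swap the two coordinates (a change-of-variables move,
   `KZ.of_sub_of_reindex_mem_relations`): coordinates `(u, x) = (w 0, w 1)`, domain
   `{0<x<1, 1<u<x+1}`, integrand `x/u`;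
2. null modification (rule 1, `KZ.of_sub_of_mem_relations_of_null`) to the compact band
   `K = {1 ≤ u ≤ 2, u−1 ≤ x ≤ 1}` — the two domains differ inside three lines;
3. Newton–Leibniz along `x` (rule 3) with the semialgebraic primitive `x²/(2u)`:
   `[K, x/u] − [[1,2], 1 − u/2] ∈ KZ.newtonLeibnizRel` (`∫_{u−1}^1 x/u dx = 1 − u/2`);
4. Newton–Leibniz along `u` with primitive `u − u²/4`:
   `[[1,2], 1 − u/2] − [pt, 1/4] ∈ KZ.newtonLeibnizRel` (`(2 − 1) − (1 − 1/4) = 1/4`).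

No definitions are made: the two intermediate representations `[K, x/u]`, `[[1,2], 1 − u/2]` are
supplied by existence lemmas and consumed through their domain/integrand equations.
Sources: J. Cresson, J. Viu-Sos, *J. Théor. Nombres Bordeaux* 34 (2022), §2.1 (the example, its
value); M. Kontsevich, D. Zagier, *Periods* (2001), §§1.1–1.2 (the rules; the unfolding device).
-/

noncomputable section

open MeasureTheory Set
open Literature.NumberTheory.Transcendental
open Literature.ModelTheory.ExponentialFields (IsSemialgebraic isSemialgebraic_univ
  isSemialgebraic_setOf_eval_le)
open MvPolynomial (aeval X C)

namespace Summit.KontsevichZagierPeriods.LiouvilleUnfolding.Calibration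

/-! ## The base `[1,2] ⊆ ℝ¹` and the band `K = {1 ≤ u ≤ 2, u − 1 ≤ x ≤ 1} ⊆ ℝ²` -/

/-- `[1,2] ⊆ ℝ¹` is `ℚ`-semialgebraic. [folklore] -/
theorem isSemialgebraic_base : IsSemialgebraic ℚ {u : Fin 1 → ℝ | 1 ≤ u 0 ∧ u 0 ≤ 2} := by
  have h1 := isSemialgebraic_setOf_eval_le (k := ℚ) (R := ℝ) (1 : MvPolynomial (Fin 1) ℚ) (X 0)
  have h2 := isSemialgebraic_setOf_eval_le (k := ℚ) (R := ℝ) (X 0 : MvPolynomial (Fin 1) ℚ) 2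
  simp only [map_one, MvPolynomial.aeval_X, map_ofNat] at h1 h2
  have hs : {u : Fin 1 → ℝ | 1 ≤ u 0 ∧ u 0 ≤ 2} = {u : Fin 1 → ℝ | 1 ≤ u 0} ∩ {u | u 0 ≤ 2} := by
    ext u
    simp only [mem_setOf_eq, mem_inter_iff]
  rw [hs]
  exact h1.inter h2

/-- `[1,2] ⊆ ℝ¹` is the order interval `Icc 1 2` of `Fin 1 → ℝ`, hence compact. [folklore] -/
theorem isCompact_base : IsCompact {u : Fin 1 → ℝ | 1 ≤ u 0 ∧ u 0 ≤ 2} := by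
  have : {u : Fin 1 → ℝ | 1 ≤ u 0 ∧ u 0 ≤ 2} = Icc (fun _ => (1 : ℝ)) (fun _ => 2) := by
    ext u
    simp only [mem_setOf_eq, mem_Icc, Pi.le_def, Fin.forall_fin_one]
  rw [this]
  exact isCompact_Icc

/-- The lower edge `u ↦ u − 1` of the band is `ℚ`-semialgebraic on the base. [folklore] -/
theorem isSemialgebraicFunOn_lower :
    IsSemialgebraicFunOn ℚ {u : Fin 1 → ℝ | 1 ≤ u 0 ∧ u 0 ≤ 2} (fun u => u 0 - 1) :=
  (isSemialgebraicFunOn_aeval isSemialgebraic_base (X 0 - 1)).congr fun u _ => by simp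

/-- The upper edge `1` of the band is `ℚ`-semialgebraic on the base. [folklore] -/
theorem isSemialgebraicFunOn_upper :
    IsSemialgebraicFunOn ℚ {u : Fin 1 → ℝ | 1 ≤ u 0 ∧ u 0 ≤ 2} (fun _ => (1 : ℝ)) :=
  (isSemialgebraicFunOn_aeval isSemialgebraic_base 1).congr fun u _ => by simp

/-- The band `K = {1 ≤ u ≤ 2, u − 1 ≤ x ≤ 1}` is the Newton–Leibniz band (`KZlog.band`) over
`[1,2]` between the edges `u − 1 ≤ 1`. [folklore] -/
theorem band_eq :
    {w : Fin 2 → ℝ | (1 ≤ w 0 ∧ w 0 ≤ 2) ∧ w 0 - 1 ≤ w 1 ∧ w 1 ≤ 1} =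
      KZlog.band {u : Fin 1 → ℝ | 1 ≤ u 0 ∧ u 0 ≤ 2} (fun u => u 0 - 1) (fun _ => 1) := by
  ext w
  exact Iff.rfl

/-- `K` is `ℚ`-semialgebraic. [folklore] -/
theorem isSemialgebraic_band :
    IsSemialgebraic ℚ {w : Fin 2 → ℝ | (1 ≤ w 0 ∧ w 0 ≤ 2) ∧ w 0 - 1 ≤ w 1 ∧ w 1 ≤ 1} := by
  rw [band_eq]
  exact KZlog.isSemialgebraic_band isSemialgebraicFunOn_lower isSemialgebraicFunOn_upper

/-- `K` is compact (closed, inside the box `[0,2]²`). [folklore] -/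
theorem isCompact_band :
    IsCompact {w : Fin 2 → ℝ | (1 ≤ w 0 ∧ w 0 ≤ 2) ∧ w 0 - 1 ≤ w 1 ∧ w 1 ≤ 1} := by
  refine (isCompact_Icc (a := fun _ : Fin 2 => (0 : ℝ)) (b := fun _ => 2)).of_isClosed_subset
    ?_ ?_
  · have hA : IsClosed {w : Fin 2 → ℝ | 1 ≤ w 0} := isClosed_le continuous_const (continuous_apply 0)
    have hB : IsClosed {w : Fin 2 → ℝ | w 0 ≤ 2} := isClosed_le (continuous_apply 0) continuous_const
    have hC : IsClosed {w : Fin 2 → ℝ | w 0 - 1 ≤ w 1} :=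
      isClosed_le ((continuous_apply 0).sub continuous_const) (continuous_apply 1)
    have hD : IsClosed {w : Fin 2 → ℝ | w 1 ≤ 1} := isClosed_le (continuous_apply 1) continuous_const
    have : {w : Fin 2 → ℝ | (1 ≤ w 0 ∧ w 0 ≤ 2) ∧ w 0 - 1 ≤ w 1 ∧ w 1 ≤ 1} =
        ({w : Fin 2 → ℝ | 1 ≤ w 0} ∩ {w | w 0 ≤ 2}) ∩ ({w | w 0 - 1 ≤ w 1} ∩ {w | w 1 ≤ 1}) := by
      ext w
      simp only [mem_setOf_eq, mem_inter_iff]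
    rw [this]
    exact (hA.inter hB).inter (hC.inter hD)
  · intro w hw
    simp only [mem_setOf_eq] at hw
    obtain ⟨⟨h1, h2⟩, h3, h4⟩ := hw
    simp only [mem_Icc, Pi.le_def, Fin.forall_fin_two]
    exact ⟨⟨by linarith, by linarith⟩, h2, by linarith⟩

/-! ## The two intermediate representations -/

/-- **The band representation** `[K, x/u]` exists (coordinates `u = w 0`, `x = w 1`; the integrand
is continuous on the compact `K`, where `u ≥ 1`). [folklore] -/
theorem exists_bandRep : ∃ R : KZ.IntegralRep 2,
    R.domain = {w : Fin 2 → ℝ | (1 ≤ w 0 ∧ w 0 ≤ 2) ∧ w 0 - 1 ≤ w 1 ∧ w 1 ≤ 1} ∧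
    R.integrand = fun w => w 1 / w 0 := by
  refine ⟨⟨{w : Fin 2 → ℝ | (1 ≤ w 0 ∧ w 0 ≤ 2) ∧ w 0 - 1 ≤ w 1 ∧ w 1 ≤ 1}, fun w => w 1 / w 0,
    isSemialgebraic_band, ?_, ?_⟩, rfl, rfl⟩
  · refine (isSemialgebraicFunOn_aeval_div_aeval isSemialgebraic_band (X 1) (X 0)
      fun w hw => ?_).congr fun w _ => by simp
    simp only [mem_setOf_eq] at hw
    simpa using (one_pos.trans_le hw.1.1).ne'
  · refine ContinuousOn.integrableOn_compact isCompact_band ?_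
    refine (continuous_apply 1).continuousOn.div (continuous_apply 0).continuousOn fun w hw => ?_
    simp only [mem_setOf_eq] at hw
    exact (one_pos.trans_le hw.1.1).ne'

/-- **The base representation** `[[1,2], 1 − u/2]` exists. [folklore] -/
theorem exists_baseRep : ∃ R : KZ.IntegralRep 1,
    R.domain = {u : Fin 1 → ℝ | 1 ≤ u 0 ∧ u 0 ≤ 2} ∧ R.integrand = fun u => 1 - u 0 / 2 := by
  refine ⟨⟨{u : Fin 1 → ℝ | 1 ≤ u 0 ∧ u 0 ≤ 2}, fun u => 1 - u 0 / 2, isSemialgebraic_base, ?_, ?_⟩,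
    rfl, rfl⟩
  · refine (isSemialgebraicFunOn_aeval isSemialgebraic_base (1 - X 0 * C (1 / 2 : ℚ))).congr
      fun u _ => ?_
    simp only [map_sub, map_one, map_mul, MvPolynomial.aeval_X, MvPolynomial.aeval_C, eq_ratCast]
    push_cast
    ring
  · exact ContinuousOn.integrableOn_compact isCompact_base
      (by fun_prop : Continuous fun u : Fin 1 → ℝ => 1 - u 0 / 2).continuousOn

/-! ## The moves -/

/-- **Moves 1–2 (rule 2, rule 1)**: after the coordinate swap `KZ.IntegralRep.reindex`, the
representation `[{0<x<1, 1<u<x+1}, x/u]` and the band representation `[K, x/u]` have domains that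
differ by null sets (inside the lines `u = 1`, `u = 2`, `x = 1`, `x = u − 1`) and integrands that
agree on the overlap, hence differ by a relation (`KZ.of_sub_of_mem_relations_of_null`).
[cite: KontsevichZagier2001, §1.2] -/
theorem reindex_sub_band_mem_relations (r : KZ.IntegralRep 2)
    (hr : r.domain = {z | 0 < z 0 ∧ z 0 < 1 ∧ 1 < z 1 ∧ z 1 < z 0 + 1})
    (hri : Set.EqOn r.integrand (fun z => z 0 / z 1) r.domain)
    (R₂ : KZ.IntegralRep 2)
    (h₂d : R₂.domain = {w : Fin 2 → ℝ | (1 ≤ w 0 ∧ w 0 ≤ 2) ∧ w 0 - 1 ≤ w 1 ∧ w 1 ≤ 1})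
    (h₂i : R₂.integrand = fun w => w 1 / w 0) :
    KZ.of (r.reindex (Equiv.swap 0 1)) - KZ.of R₂ ∈ KZ.relations := by
  have hmem : ∀ w : Fin 2 → ℝ, w ∈ (r.reindex (Equiv.swap 0 1)).domain ↔
      0 < w 1 ∧ w 1 < 1 ∧ 1 < w 0 ∧ w 0 < w 1 + 1 := fun w => by
    simp only [KZ.IntegralRep.reindex_domain, hr, mem_setOf_eq, Equiv.swap_apply_left,
      Equiv.swap_apply_right]
  refine KZ.of_sub_of_mem_relations_of_null _ _ ?_ ?_ ?_
  · -- the open region lies inside the band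
    have hsub : (r.reindex (Equiv.swap 0 1)).domain ⊆ R₂.domain := by
      intro w hw
      rw [hmem] at hw
      rw [h₂d]
      simp only [mem_setOf_eq]
      obtain ⟨h1, h2, h3, h4⟩ := hw
      exact ⟨⟨h3.le, by linarith⟩, by linarith, h2.le⟩
    exact measure_mono_null (fun w hw => (hw.2 (hsub hw.1)).elim) measure_empty
  · -- the band minus the open region lies in four lines
    have hsub : R₂.domain \ (r.reindex (Equiv.swap 0 1)).domain ⊆
        ({w : Fin 2 → ℝ | w 0 = 1} ∪ {w | w 0 = 2} ∪ {w | w 1 = 1}) ∪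
          {z : Fin 2 → ℝ | Fin.init z ∈ (Set.univ : Set (Fin 1 → ℝ)) ∧
            z (Fin.last 1) = (fun u : Fin 1 → ℝ => u 0 - 1) (Fin.init z)} := by
      intro w hw
      obtain ⟨hwK, hn⟩ := hw
      rw [h₂d] at hwK
      rw [hmem] at hn
      simp only [mem_setOf_eq] at hwK
      obtain ⟨⟨h1, h2⟩, h3, h4⟩ := hwK
      simp only [mem_union, mem_setOf_eq, mem_univ, true_and]
      by_cases c1 : w 0 = 1
      · exact Or.inl (Or.inl (Or.inl c1))
      by_cases c2 : w 0 = 2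
      · exact Or.inl (Or.inl (Or.inr c2))
      by_cases c3 : w 1 = 1
      · exact Or.inl (Or.inr c3)
      by_cases c4 : w 1 = w 0 - 1
      · exact Or.inr c4
      have h3' : w 0 - 1 < w 1 := lt_of_le_of_ne h3 (Ne.symm c4)
      exact (hn ⟨by linarith, lt_of_le_of_ne h4 c3, lt_of_le_of_ne h1 (Ne.symm c1),
        by linarith⟩).elim
    refine measure_mono_null hsub
      (measure_union_null (measure_union_null (measure_union_null ?_ ?_) ?_) ?_)
    · rw [MeasureTheory.volume_pi]; exact Measure.pi_hyperplane _ _ _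
    · rw [MeasureTheory.volume_pi]; exact Measure.pi_hyperplane _ _ _
    · rw [MeasureTheory.volume_pi]; exact Measure.pi_hyperplane _ _ _
    · have hu : IsSemialgebraicFunOn ℚ (Set.univ : Set (Fin 1 → ℝ)) (fun u => u 0 - 1) :=
        (isSemialgebraicFunOn_aeval isSemialgebraic_univ (X 0 - 1)).congr fun u _ => by simp
      exact KZ.volume_graph_eq_zero hu
  · -- the integrands agree on the overlap
    intro w hw
    have hw' : (fun i => w (Equiv.swap (0 : Fin 2) 1 i)) ∈ r.domain := hw.1
    simp only [KZ.IntegralRep.reindex_integrand, h₂i]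
    rw [hri hw']
    simp only [Equiv.swap_apply_left, Equiv.swap_apply_right]

/-- **Move 3 (rule 3 along `x`)**: `[K, x/u] − [[1,2], 1 − u/2]` is ONE Newton–Leibniz move with
the semialgebraic primitive `x²/(2u)` on the band (`∫_{u−1}^{1} x/u dx = (1 − (u−1)²)/(2u) = 1 − u/2`).
[cite: KontsevichZagier2001, §1.2] -/
theorem band_sub_base_mem_newtonLeibnizRel (R₂ : KZ.IntegralRep 2) (R₁ : KZ.IntegralRep 1)
    (h₂d : R₂.domain = {w : Fin 2 → ℝ | (1 ≤ w 0 ∧ w 0 ≤ 2) ∧ w 0 - 1 ≤ w 1 ∧ w 1 ≤ 1})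
    (h₂i : R₂.integrand = fun w => w 1 / w 0)
    (h₁d : R₁.domain = {u : Fin 1 → ℝ | 1 ≤ u 0 ∧ u 0 ≤ 2})
    (h₁i : R₁.integrand = fun u => 1 - u 0 / 2) :
    KZ.of R₂ - KZ.of R₁ ∈ KZ.newtonLeibnizRel := by
  -- coordinates of `Fin.snoc u t : ℝ²`: `(u 0, t)`
  have hs0 : ∀ (u : Fin 1 → ℝ) (t : ℝ), (Fin.snoc u t : Fin 2 → ℝ) 0 = u 0 := fun u t =>
    Fin.snoc_castSucc (α := fun _ => ℝ) (x := t) (p := u) (i := 0)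
  have hs1 : ∀ (u : Fin 1 → ℝ) (t : ℝ), (Fin.snoc u t : Fin 2 → ℝ) 1 = t := fun u t =>
    Fin.snoc_last (α := fun _ => ℝ) (x := t) (p := u)
  refine ⟨1, R₂, R₁, fun u => u 0 - 1, fun _ => 1, fun w => w 1 * w 1 / (2 * w 0),
    ?_, ?_, ?_, ?_, ?_, ?_, ?_, ?_, rfl⟩
  · -- the primitive is semialgebraic on the band
    rw [h₂d]
    refine (isSemialgebraicFunOn_aeval_div_aeval isSemialgebraic_band (X 1 * X 1) (2 * X 0)
      fun w hw => ?_).congr fun w _ => by simp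
    simp only [mem_setOf_eq] at hw
    simpa using (one_pos.trans_le hw.1.1).ne'
  · rw [h₁d]; exact isSemialgebraicFunOn_lower
  · rw [h₁d]; exact isSemialgebraicFunOn_upper
  · intro u hu
    rw [h₁d] at hu
    simp only [mem_setOf_eq] at hu
    linarith [hu.2]
  · rw [h₂d, h₁d]; exact band_eq
  · intro u _
    simp only [hs0, hs1]
    exact (by fun_prop : Continuous fun t : ℝ => t * t / (2 * u 0)).continuousOn
  · intro u hu t _
    rw [h₁d] at hu
    simp only [mem_setOf_eq] at hu
    have hu0 : u 0 ≠ 0 := (one_pos.trans_le hu.1).ne'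
    simp only [hs0, hs1, h₂i]
    refine (((hasDerivAt_id' t).mul (hasDerivAt_id' t)).div_const (2 * u 0)).congr_deriv ?_
    field_simp
    ring
  · intro u hu
    rw [h₁d] at hu
    simp only [mem_setOf_eq] at hu
    have hu0 : u 0 ≠ 0 := (one_pos.trans_le hu.1).ne'
    simp only [hs0, hs1, h₁i]
    field_simp
    ring

/-- **Move 4 (rule 3 along `u`)**: `[[1,2], 1 − u/2] − [pt, 1/4]` is ONE Newton–Leibniz move with
primitive `u − u²/4` (`(2 − 1) − (1 − 1/4) = 1/4`), the base being ANY constant representation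
`[pt, 1/4]`. [cite: KontsevichZagier2001, §1.2] -/
theorem base_sub_const_mem_newtonLeibnizRel (R₁ : KZ.IntegralRep 1) (r' : KZ.IntegralRep 0)
    (h₁d : R₁.domain = {u : Fin 1 → ℝ | 1 ≤ u 0 ∧ u 0 ≤ 2})
    (h₁i : R₁.integrand = fun u => 1 - u 0 / 2)
    (hd : r'.domain = Set.univ) (hi : Set.EqOn r'.integrand (fun _ => 1 / 4) r'.domain) :
    KZ.of R₁ - KZ.of r' ∈ KZ.newtonLeibnizRel := by
  -- coordinate of `Fin.snoc x t : ℝ¹`: `t`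
  have hs : ∀ (x : Fin 0 → ℝ) (t : ℝ), (Fin.snoc x t : Fin 1 → ℝ) 0 = t := fun x t =>
    Fin.snoc_last (α := fun _ => ℝ) (x := t) (p := x)
  refine ⟨0, R₁, r', fun _ => 1, fun _ => 2, fun w => w 0 - w 0 * w 0 / 4,
    ?_, ?_, ?_, ?_, ?_, ?_, ?_, ?_, rfl⟩
  · rw [h₁d]
    refine (isSemialgebraicFunOn_aeval isSemialgebraic_base
      (X 0 - X 0 * X 0 * C (1 / 4 : ℚ))).congr fun u _ => ?_
    simp only [map_sub, map_mul, MvPolynomial.aeval_X, MvPolynomial.aeval_C, eq_ratCast]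
    push_cast
    ring
  · rw [hd]
    exact (isSemialgebraicFunOn_aeval isSemialgebraic_univ (1 : MvPolynomial (Fin 0) ℚ)).congr
      fun u _ => by simp
  · rw [hd]
    exact (isSemialgebraicFunOn_aeval isSemialgebraic_univ (2 : MvPolynomial (Fin 0) ℚ)).congr
      fun u _ => by simp
  · intro _ _
    norm_num
  · rw [h₁d, hd]
    ext z
    simp only [mem_setOf_eq, mem_univ, true_and, Fin.last_zero]
  · intro x _
    simp only [hs]
    exact (by fun_prop : Continuous fun t : ℝ => t - t * t / 4).continuousOn
  · intro x _ t _
    simp only [hs, h₁i]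
    refine ((hasDerivAt_id' t).sub
      (((hasDerivAt_id' t).mul (hasDerivAt_id' t)).div_const 4)).congr_deriv ?_
    ring
  · intro x hx
    rw [hi hx]
    simp only [hs]
    norm_num

/-! ## The calibration -/

/-- **`CVSQuarter`** (stmt-KontsevichZagierPeriods-2838): the Cresson–Viu-Sos calibration
`[{0<x<1<y<x+1}, x/y] ∼ [pt, 1/4]` holds in the Kontsevich–Zagier calculus of moves — swap the
coordinates, pass to the compact band `K` by a null modification, and integrate twice by
Newton–Leibniz with the semialgebraic primitives `x²/(2u)` and `u − u²/4`; no logarithm appears.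
[cite: CressonViusos2022, §2.1] -/
theorem CVSQuarter_proof :
    Summit.KontsevichZagierPeriods.KontsevichZagierPeriods.Theses.LiouvilleUnfolding.CVSQuarter := by
  unfold Summit.KontsevichZagierPeriods.KontsevichZagierPeriods.Theses.LiouvilleUnfolding.CVSQuarter
  intro r r' hr hri hr' hri'
  obtain ⟨R₂, h₂d, h₂i⟩ := exists_bandRep
  obtain ⟨R₁, h₁d, h₁i⟩ := exists_baseRep
  have e1 : KZ.of r - KZ.of (r.reindex (Equiv.swap 0 1)) ∈ KZ.relations :=
    KZ.of_sub_of_reindex_mem_relations r _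
  have e2 : KZ.of (r.reindex (Equiv.swap 0 1)) - KZ.of R₂ ∈ KZ.relations :=
    reindex_sub_band_mem_relations r hr hri R₂ h₂d h₂i
  have e3 : KZ.of R₂ - KZ.of R₁ ∈ KZ.relations :=
    KZ.newtonLeibnizRel_subset_relations
      (band_sub_base_mem_newtonLeibnizRel R₂ R₁ h₂d h₂i h₁d h₁i)
  have e4 : KZ.of R₁ - KZ.of r' ∈ KZ.relations :=
    KZ.newtonLeibnizRel_subset_relations
      (base_sub_const_mem_newtonLeibnizRel R₁ r' h₁d h₁i hr' hri')
  have hsum : KZ.of r - KZ.of r' =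
      (KZ.of r - KZ.of (r.reindex (Equiv.swap 0 1))) +
        (KZ.of (r.reindex (Equiv.swap 0 1)) - KZ.of R₂) + (KZ.of R₂ - KZ.of R₁) +
        (KZ.of R₁ - KZ.of r') := by
    abel
  show KZ.of r - KZ.of r' ∈ KZ.relations
  rw [hsum]
  exact add_mem (add_mem (add_mem e1 e2) e3) e4

end Summit.KontsevichZagierPeriods.LiouvilleUnfolding.Calibration

end
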